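import Mathlib.Topology.Algebra.OpenSubgroup
import Literature.AnabelianGeometry.SemiGraphs.CosetCategoriesFSM
import HarnessLib

/-!
# The small coset category `CosetCat G` of a slim profinite group is a slim category

Mochizuki, *The geometry of Frobenioids II*, Kyushu J. Math. **62** (2008) 401–460, §1 Example 1.1 (i),
author's text p. 7 [cite: MochizukiFrdII2008, Ex 1.1 (i) p.7]: "`C₀` … over a slim base category `D₀`
[cf. [AbsAnab], Theorem 1.1.1, (ii); [FrdI], Theorem 6.2, (iv); [FrdI], Theorem 6.4, (i)]" — `D₀` being "the full
subcategory of connected objects of the Galois category of finite étale coverings of `Spec(ℚ_p)`"; and [FrdI] §0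
p. 14 [cite: MochizukiFrdI2008, §0 p.14]: "a category `C` is *slim* if the natural functor `C_A → C` is rigid
[has no nontrivial automorphisms] for every `A ∈ Ob(C)`", a topological group is *slim* if every open subgroup
has trivial centraliser (p. 13).

PROOF-ONLY (no definitions). For the SMALL model `CosetCat G` of `𝓑(G)⁰` (abc-iut-L5-t2's `CosetCategories.lean`:
objects the open subgroups `U` standing for `G/U`, morphisms the `G`-equivariant maps) of a COMPACT topological
group `G` whose open subgroups separate points (e.g. a profinite group; an absolute Galois group with its Krull
topology) we prove the passage from group-slimness to category-slimness that the printed cross-reference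
"[AbsAnab] Thm. 1.1.1 (ii)" (slimness of `G_K`) ⇒ "slim base category `D₀`" uses silently:

* `CosetCat.exists_lift_of_forget_iso` — for an automorphism `α` of `(CosetCat G)_A → CosetCat G` and a point
  `c ∈ G/U_A`, the classes `α_{(G/W, c)}(1·W) ∈ G/W` (`W` open, fixing `c`) form a compatible system, hence (Cantor
  intersection of the closed cosets in the compact `G`) come from one `ν ∈ G`;
* `CosetCat.isSlim_of_isSlimGroup` — naturality of `α` along the twisted maps `G/(W ∩ gWg⁻¹) → G/W`, `1 ↦ g·W`
  (`g ∈ Stab(c)`) gives `gν = νg`, so `ν` centralises the open subgroup `Stab(c)`, so `ν = 1` by slimness of `G`: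
  every component of `α` is the identity, i.e. `(CosetCat G)_A → CosetCat G` is rigid — **`CosetCat G` is slim**.

Used by abc-iut-L1-t4's `PadicFrobenioidCZeroGalois*.lean` (`D₀ = CosetCat G_{ℚ_p}` is slim, hence — [FrdII]
Thm. 1.2 (iv), abc-iut-L1-d8 — `C₀` is slim). Pure topological-group / category theory over Mathlib; nothing of
the disputed series is asserted; no statement of the papers is strengthened.
-/

namespace Literature.AnabelianGeometry.SemiGraphs

namespace CosetCat

open CategoryTheory Literature.AlgebraicGeometry.Frobenioids
open scoped Pointwise

universe u

variable {G : Type u} [Group G] [TopologicalSpace G]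

/-! ### Bookkeeping in `CosetCat G`: classes picked by commuting squares -/

/-- For a commutative square `l ≫ a₂ = a₁ ≫ l` of `CosetCat G` with `l : G/W₁ → G/W₂`, `1·W₁ ↦ g·W₂`, and
`a₁(1·W₁) = m·W₁`: `g · a₂(1·W₂) = m g · W₂`. [cite: MochizukiFrdI2008, §0 p.14] -/
theorem smul_pt_eq_of_comm_sq {X₁ X₂ : CosetCat G} (a₁ : X₁ ⟶ X₁) (a₂ : X₂ ⟶ X₂) (l : X₁ ⟶ X₂)
    (hnat : l ≫ a₂ = a₁ ≫ l) (g m : G) (hl : pt l = ((g : G) : X₂.carrier))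
    (hm : pt a₁ = ((m : G) : X₁.carrier)) : g • pt a₂ = ((m * g : G) : X₂.carrier) := by
  have h := congrArg pt hnat
  rw [pt_comp, pt_comp, hl, hm, toFun_coe, toFun_coe, hl, MulAction.Quotient.smul_coe, smul_eq_mul] at h
  exact h

/-- From `q = ν·W` and `g · q = n·W`: `n⁻¹ g ν ∈ W`. [cite: MochizukiFrdI2008, §0 p.14] -/
theorem mem_of_smul_eq_coe {X : CosetCat G} {q : X.carrier} {g ν n : G} (hq : q = ((ν : G) : X.carrier))
    (h : g • q = ((n : G) : X.carrier)) : n⁻¹ * (g * ν) ∈ X.sg := by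
  rw [hq, MulAction.Quotient.smul_coe, smul_eq_mul] at h
  exact QuotientGroup.eq.mp h.symm

/-- From `1 · q = (n·1)·W`: `q = n·W`. [cite: MochizukiFrdI2008, §0 p.14] -/
theorem eq_coe_of_one_smul_eq {X : CosetCat G} {q : X.carrier} {n : G}
    (h : (1 : G) • q = ((n * 1 : G) : X.carrier)) : q = ((n : G) : X.carrier) := by
  rwa [one_smul, mul_one] at h

/-! ### Naturality of an automorphism of `(CosetCat G)_A → CosetCat G` -/

/-- The KEY RELATION: if `k : (G/W₁, c₁) → (G/W₂, c₂)` over `A` sends `1·W₁ ↦ g·W₂` and an automorphism `α` of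
`(CosetCat G)_A → CosetCat G` picks the classes `m·W₁ ∈ G/W₁`, resp. `q₂ ∈ G/W₂`, then `g · q₂ = m g · W₂`
(naturality of `α` along `k`). [cite: MochizukiFrdI2008, §0 p.14] -/
theorem forget_iso_relation {A : CosetCat G} (α : Over.forget A ≅ Over.forget A) {O₁ O₂ : Over A}
    (k : O₁ ⟶ O₂) (g m : G) (hk : pt k.left = ((g : G) : O₂.left.carrier))
    (hm : pt (α.hom.app O₁) = ((m : G) : O₁.left.carrier)) :
    g • pt (α.hom.app O₂) = ((m * g : G) : O₂.left.carrier) :=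
  smul_pt_eq_of_comm_sq (X₁ := O₁.left) (X₂ := O₂.left) (α.hom.app O₁) (α.hom.app O₂) k.left
    (α.hom.naturality k) g m hk hm

/-! ### Step A: the compatible system of classes lifts to an element of the compact group -/

/-- Two open subgroups `W ≤ W'` of `Stab(c)` give the objects `(G/W, c)`, `(G/W', c)` of `(CosetCat G)_A` joined
by the projection `G/W → G/W'` over `A`, along which the classes picked by `α` are compatible.
[cite: MochizukiFrdI2008, §0 p.14] -/
theorem forget_iso_compat {A : CosetCat G} (α : Over.forget A ≅ Over.forget A)
    (c : A.carrier) {W W' : OpenSubgroup G} (hW : ∀ u ∈ W, u • c = c) (hW' : ∀ u ∈ W', u • c = c) (hle : W ≤ W')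
    (g : G)
    (hg : pt (α.hom.app (Over.mk (homMk c hW : (⟨W⟩ : CosetCat G) ⟶ A))) =
      ((g : G) : (⟨W⟩ : CosetCat G).carrier)) :
    pt (α.hom.app (Over.mk (homMk c hW' : (⟨W'⟩ : CosetCat G) ⟶ A))) =
      ((g : G) : (⟨W'⟩ : CosetCat G).carrier) := by
  -- the projection `G/W → G/W'` as a morphism over `A`
  have hfix : ∀ u ∈ (⟨W⟩ : CosetCat G).sg,
      u • ((1 : G) : (⟨W'⟩ : CosetCat G).carrier) = ((1 : G) : (⟨W'⟩ : CosetCat G).carrier) :=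
    fun u hu => by
      rw [smul_coe_eq_coe_iff, inv_one, one_mul, mul_one]
      exact hle hu
  let kl : (⟨W⟩ : CosetCat G) ⟶ ⟨W'⟩ := homMk ((1 : G) : (⟨W'⟩ : CosetCat G).carrier) hfix
  have hkw : kl ≫ (homMk c hW' : (⟨W'⟩ : CosetCat G) ⟶ A) = homMk c hW :=
    hom_ext (by rw [pt_comp, pt_homMk, homMk_toFun_coe, one_smul, pt_homMk])
  let k : Over.mk (homMk c hW : (⟨W⟩ : CosetCat G) ⟶ A) ⟶ Over.mk (homMk c hW' : (⟨W'⟩ : CosetCat G) ⟶ A) :=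
    Over.homMk kl hkw
  exact eq_coe_of_one_smul_eq (forget_iso_relation α k 1 g (pt_homMk _ hfix) hg)

/-- **Step A** (for FrdII Ex. 1.1 (i)'s "slim base category", via [FrdI] §0): for a COMPACT `G`, an automorphism
`α` of `(CosetCat G)_A → CosetCat G` and a point `c ∈ G/U_A` whose stabiliser contains an open subgroup, the
classes `α_{(G/W, c)}(1·W)` (`W` open, `W ⊆ Stab(c)`) all come from ONE element `ν ∈ G` (Cantor's intersection
theorem for the closed cosets they define). [cite: MochizukiFrdI2008, §0 p.14] -/
theorem exists_lift_of_forget_iso [IsTopologicalGroup G] [CompactSpace G] {A : CosetCat G}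
    (α : Over.forget A ≅ Over.forget A) (c : A.carrier) (W₀ : OpenSubgroup G) (hW₀ : ∀ u ∈ W₀, u • c = c) :
    ∃ ν : G, ∀ (W : OpenSubgroup G) (hW : ∀ u ∈ W, u • c = c),
      pt (α.hom.app (Over.mk (homMk c hW : (⟨W⟩ : CosetCat G) ⟶ A))) =
        ((ν : G) : (⟨W⟩ : CosetCat G).carrier) := by
  let ι := {W : OpenSubgroup G // ∀ u ∈ W, u • c = c}
  haveI : Nonempty ι := ⟨⟨W₀, hW₀⟩⟩
  let q : ∀ W : ι, (⟨W.1⟩ : CosetCat G).carrier := fun W =>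
    pt (α.hom.app (Over.mk (homMk c W.2 : (⟨W.1⟩ : CosetCat G) ⟶ A)))
  let t : ι → Set G := fun W => {g : G | ((g : G) : (⟨W.1⟩ : CosetCat G).carrier) = q W}
  -- directedness, from the compatibility along projections
  have hdir : Directed (· ⊇ ·) t := fun W₁ W₂ => by
    refine ⟨⟨W₁.1 ⊓ W₂.1, fun u hu => W₁.2 u (OpenSubgroup.mem_inf.mp hu).1⟩, fun g hg => ?_, fun g hg => ?_⟩
    · exact (forget_iso_compat α c _ W₁.2 inf_le_left g hg.symm).symm
    · exact (forget_iso_compat α c _ W₂.2 inf_le_right g hg.symm).symm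
  have hne : ∀ W, (t W).Nonempty := fun W => by
    obtain ⟨g, hg⟩ := QuotientGroup.mk_surjective (q W)
    exact ⟨g, hg⟩
  -- each `t W` is a left coset of the open (hence closed) subgroup `W`
  have hclosed : ∀ W, IsClosed (t W) := fun W => by
    obtain ⟨n, hn⟩ := QuotientGroup.mk_surjective (q W)
    have ht : t W = n • ((W.1 : Set G)) := by
      ext g
      rw [mem_leftCoset_iff]
      change ((g : G) : (⟨W.1⟩ : CosetCat G).carrier) = q W ↔ _
      rw [← hn, eq_comm]
      exact QuotientGroup.eq
    rw [ht]
    exact (OpenSubgroup.isClosed W.1).leftCoset n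
  have hcpt : ∀ W, IsCompact (t W) := fun W => (hclosed W).isCompact
  obtain ⟨ν, hν⟩ :=
    IsCompact.nonempty_iInter_of_directed_nonempty_isCompact_isClosed t hdir hne hcpt hclosed
  refine ⟨ν, fun W hW => ?_⟩
  have h := Set.mem_iInter.mp hν ⟨W, hW⟩
  exact h.symm

/-! ### Steps B–D: naturality along twisted maps, slimness of `G`, conclusion -/

/-- **`CosetCat G` is a slim category** ([FrdI] §0 p. 14) for a compact topological group `G` whose open
subgroups separate points and have trivial centralisers (`IsSlimGroup`; e.g. a slim profinite group such as
`G_{ℚ_p}`, [AbsAnab] Thm. 1.1.1 (ii)) — the passage "`G` slim ⇒ `𝓑(G)⁰` slim" implicit in FrdII Ex. 1.1 (i)'s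
"over a slim base category `D₀`". PROOF: Step A gives `ν` with `α_{(G/W,c)}(1·W) = ν·W` for all open
`W ⊆ Stab(c)`; for `g ∈ Stab(c)` the twisted map `G/(W ∩ gWg⁻¹) → G/W`, `1 ↦ g·W`, is a morphism over `A`, and
naturality of `α` along it reads `gν ≡ νg (mod W)`; as the `W` separate points, `gν = νg`, so `ν` centralises
the open subgroup `Stab(c)`, whence `ν = 1` and `α = id`. [cite: MochizukiFrdII2008, Ex 1.1 (i) p.7] -/
theorem isSlim_of_isSlimGroup [IsTopologicalGroup G] [CompactSpace G]
    (hsep : ∀ x : G, x ≠ 1 → ∃ W : OpenSubgroup G, x ∉ (W : Set G)) (hZ : IsSlimGroup G) :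
    IsSlim (CosetCat G) := by
  refine ⟨fun A α => ?_⟩
  -- it suffices to show every component is the identity
  suffices happ : ∀ O : Over A, α.hom.app O = 𝟙 _ by
    ext O
    rw [happ O, Iso.refl_hom, NatTrans.id_app]
  intro O
  -- the point `c` of the structure map; the open subgroup `W₀ = U_O` lies in `Stab(c)`
  set c : A.carrier := pt O.hom with hc
  have hW₀ : ∀ u ∈ O.left.sg, u • c = c := fun u hu => smul_pt O.hom hu
  -- Step A
  obtain ⟨ν, hν⟩ := exists_lift_of_forget_iso α c O.left.sg hW₀
  -- the open subgroups inside `Stab(c)` separate points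
  have hsep' : ∀ x : G, (∀ (W : OpenSubgroup G), (∀ u ∈ W, u • c = c) → x ∈ W) → x = 1 := by
    intro x hx
    by_contra hx1
    obtain ⟨W₁, hW₁⟩ := hsep x hx1
    exact hW₁ (OpenSubgroup.mem_inf.mp (hx (W₁ ⊓ O.left.sg)
      (fun u hu => hW₀ u (OpenSubgroup.mem_inf.mp hu).2))).1
  -- Step B: `ν` commutes with every `g ∈ Stab(c)`
  have hcomm : ∀ g : G, g • c = c → g * ν = ν * g := by
    intro g hgc
    have key : ∀ (W : OpenSubgroup G), (∀ u ∈ W, u • c = c) → (ν * g)⁻¹ * (g * ν) ∈ W := by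
      intro W hW
      -- `W' := W ∩ g W g⁻¹`, an open subgroup fixing `c` and the coset `g·W`
      let Wg : OpenSubgroup G := W.comap (MulAut.conj g⁻¹).toMonoidHom
        ((continuous_const.mul continuous_id).mul continuous_const)
      have hWg : ∀ u ∈ Wg, g⁻¹ * u * g ∈ W := fun u hu => by
        have hu' : (MulAut.conj g⁻¹) u ∈ W := hu
        rwa [MulAut.conj_apply, inv_inv] at hu'
      let W' : OpenSubgroup G := W ⊓ Wg
      have hW' : ∀ u ∈ W', u • c = c := fun u hu => hW u (OpenSubgroup.mem_inf.mp hu).1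
      have hfix : ∀ u ∈ (⟨W'⟩ : CosetCat G).sg,
          u • ((g : G) : (⟨W⟩ : CosetCat G).carrier) = ((g : G) : (⟨W⟩ : CosetCat G).carrier) :=
        fun u hu => (smul_coe_eq_coe_iff _ u g).mpr (hWg u (OpenSubgroup.mem_inf.mp hu).2)
      -- the twisted map `G/W' → G/W`, `1 ↦ g·W`: a morphism `(G/W', c) → (G/W, c)` over `A` since `g·c = c`
      let kl : (⟨W'⟩ : CosetCat G) ⟶ ⟨W⟩ := homMk ((g : G) : (⟨W⟩ : CosetCat G).carrier) hfix
      have hkw : kl ≫ (homMk c hW : (⟨W⟩ : CosetCat G) ⟶ A) = homMk c hW' :=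
        hom_ext (by rw [pt_comp, pt_homMk, homMk_toFun_coe, hgc, pt_homMk])
      let k : Over.mk (homMk c hW' : (⟨W'⟩ : CosetCat G) ⟶ A) ⟶
          Over.mk (homMk c hW : (⟨W⟩ : CosetCat G) ⟶ A) :=
        Over.homMk kl hkw
      -- naturality along `k`: `g · (ν·W) = ν g · W`, i.e. `(νg)⁻¹ g ν ∈ W`
      exact mem_of_smul_eq_coe (hν W hW) (forget_iso_relation α k g ν (pt_homMk _ hfix) (hν W' hW'))
    have h1 : (ν * g)⁻¹ * (g * ν) = 1 := hsep' _ key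
    rw [inv_mul_eq_one] at h1
    exact h1.symm
  -- Step C: `ν` centralises the open subgroup `Stab(c)`, hence `ν = 1`
  have hν1 : ν = 1 := by
    have hopen : IsOpen ((MulAction.stabilizer G c : Subgroup G) : Set G) :=
      Subgroup.isOpen_mono (H₁ := O.left.sg.toSubgroup)
        (fun u hu => MulAction.mem_stabilizer_iff.mpr (hW₀ u hu)) O.left.sg.isOpen
    have hmem : ν ∈ Subgroup.centralizer ((MulAction.stabilizer G c : Subgroup G) : Set G) := by
      rw [Subgroup.mem_centralizer_iff]
      intro g hg
      exact hcomm g (MulAction.mem_stabilizer_iff.mp hg)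
    rw [hZ.centralizer_eq_bot _ hopen] at hmem
    exact Subgroup.mem_bot.mp hmem
  -- Step D: the component at `O` is the identity (compare with the object `(G/W₀, c)` along the identity map)
  have hfixc : ∀ u ∈ (O.left : CosetCat G).sg,
      u • ((1 : G) : (⟨O.left.sg⟩ : CosetCat G).carrier) = ((1 : G) : (⟨O.left.sg⟩ : CosetCat G).carrier) :=
    fun u hu => by
      rw [smul_coe_eq_coe_iff, inv_one, one_mul, mul_one]
      exact hu
  let kl : O.left ⟶ (⟨O.left.sg⟩ : CosetCat G) := homMk ((1 : G) : (⟨O.left.sg⟩ : CosetCat G).carrier) hfixc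
  have hkw : kl ≫ (homMk c hW₀ : (⟨O.left.sg⟩ : CosetCat G) ⟶ A) = O.hom :=
    hom_ext (by rw [pt_comp, pt_homMk, homMk_toFun_coe, one_smul, hc])
  let k : O ⟶ Over.mk (homMk c hW₀ : (⟨O.left.sg⟩ : CosetCat G) ⟶ A) := Over.homMk kl hkw
  obtain ⟨m, hm⟩ := QuotientGroup.mk_surjective (pt (α.hom.app O))
  have h := forget_iso_relation α k 1 m (pt_homMk _ hfixc) hm.symm
  -- `h : 1 · (ν·W₀) = (m·1)·W₀` with `ν = 1`, so `m ∈ W₀`: the class picked by `α` at `O` is trivial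
  have h2 := mem_of_smul_eq_coe (hν O.left.sg hW₀) h
  simp only [hν1, mul_one] at h2
  have h3 : ((m : G) : O.left.carrier) = ((1 : G) : O.left.carrier) :=
    QuotientGroup.eq.mpr (by rw [mul_one]; exact h2)
  apply hom_ext
  exact hm.symm.trans (h3.trans (pt_id _).symm)

end CosetCat

end Literature.AnabelianGeometry.SemiGraphs
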